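import Summits.HodgeConjecture.HodgeConjecture.Theses.KuznetsovCYFactory
import HarnessLib

/-!
# Route `KuznetsovCYFactory`, glue `CubicTenfoldHC` (stmt-HodgeConjecture-1886)

Pure logic: the Hodge conjecture for every smooth cubic tenfold from Hodge models (antecedent),
iso-invariance of algebraic classes, the off-middle hypersurface case, the transport statement along
the cubic-tenfold family and the anchors. Split `2p = 10` (anchors give a family, a rational section
`α` of type `(5,5)` everywhere, algebraic at `s₀` and restricting to `c` at `s₁` through
`e : X ≅ 𝒳_{s₁}`; transport from `s₀` to `s₁`; pull back along `e`) versus `2p ≠ 10` (off-middle).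
-/

set_option linter.dupNamespace false

namespace Summit.HodgeConjecture.HodgeConjecture.Theorems

/-- **Glue `CubicTenfoldHC` of route `KuznetsovCYFactory`** (stmt-HodgeConjecture-1886):
`HodgeModels → AlgebraicClassesIsoInvariant → HypersurfaceOffMiddleHC → CubicTenfoldTransport →
CubicTenfoldAnchors →` the Hodge conjecture for every smooth cubic tenfold. Pure logic (see the
module docstring). -/
theorem kuznetsovCYFactory_cubicTenfoldHC_proof :
    Summit.HodgeConjecture.HodgeConjecture.Theses.KuznetsovCYFactory.CubicTenfoldHC := by
  intro hModels hIso hOff hTr hAnch X hX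
  refine ⟨hModels 10 X hX.1, fun p c hc hpp ↦ ?_⟩
  by_cases hp : 2 * p = 10
  · obtain rfl : p = 5 := by omega
    obtain ⟨𝒳, S, f, s₀, s₁, e, α, hfam, hconn, hfib, hα, hαt, hec, halg₀⟩ := hAnch X hX c hc hpp
    have halg₁ := hTr 𝒳 S f hfam hconn hfib α hα hαt s₀ s₁ halg₀
    have h := hIso X _ e 5 _ halg₁
    rwa [hec] at h
  · exact hOff 10 3 X hX p hp c hc hpp

end Summit.HodgeConjecture.HodgeConjecture.Theorems
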